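import Summits.AtomisticToContinuum.Crystallization.Theorems.ReggeStarCoercivityDefectFreeCrystallizesPalmDefs
import Summits.AtomisticToContinuum.Crystallization.Theorems.PalmUnimodularRigidityPalmToHinge
import Summits.AtomisticToContinuum.Crystallization.Theorems.PalmUnimodularRigidityCruxesToPalmRigidity
import Literature.Probability.Process.PointStationaryLaw

/-!
# `stub_chargeFromLaw : ChargeFromLaw` — P5 of line `palm-good-law` (crux stmt-AtomisticToContinuum-13603, `ReggeStarCoercivity.DefectFreeCrystallizes`)

**Statement** (`PalmGoodLaw.ChargeFromLaw`).
`GoodLawOfZeroDefects → FunnelToShells → ShellsToBarlowChart → LayeredLawsSelectHcp →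
(every LJ ground-state sequence has defect fraction → 0) → GroundStatesChargePeriodic`.

**Proof** (pure bookkeeping over proved helpers; it is item 9228 `CruxesToPalmRigidity` followed by
item 9231 `PalmToHinge`, both relativised from "all minimising laws" to "the good limit law of this
sequence `x`").  Fix a ground-state sequence `x`.

1. `GoodLawOfZeroDefects` gives a good Benjamini–Schramm limit law `(φ, δ, P)` of `x`
   (`GoodLimitLaw`: hard core, Mecke identity, energy identity, density transfer, and a.s. every point
   `SetGood`).  By `CrysEnergyLimit_holds` and uniqueness of limits `E_P[h] = e*`, so `P` is minimising.
2. `FunnelToShells` gives the `(1/100)`-close-packed ROOT shell a.s.; hard-core configurations are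
   locally finite (`count_restrict_floorNorm_preimage_lt_top`), so "everything shows at the root"
   (`ae_forall_map_sub_of_ae`) gives close-packed shells at EVERY point a.s. (the re-rooted shell is
   identified by `map_sub_count_restrict` + `shell_image_sub_eq`); `ShellsToBarlowChart` (as `0 ∈ S`)
   gives the global Barlow chart and `LayeredLawsSelectHcp` makes `P`-a.e. configuration a rotated
   relaxed hcp crystal `count|A(hcpStacking a h)` with `(a, h) ∈ [1/2, 2]²`.
3. Verbatim the end of `palmToHinge_proof`: a support point `(a₀, h₀)` of the parameter law
   (`exists_mem_forall_nhds_measure_ne_zero`), `Q := hcpPeriodicConfiguration a₀ h₀` with base point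
   `0`, nearby parameters give `(R, ε)`-matched crystals (`matched_hcp_of_matched_near`), and the
   density-transfer clause charges `≥ ρ N` particles eventually along `φ`, hence frequently in `N`.
-/

noncomputable section

open scoped ENNReal
open Filter Topology MeasureTheory Set

namespace Summit.AtomisticToContinuum.Crystallization.Theorems.PalmGoodLaw

open Summit.AtomisticToContinuum.Crystallization.Theses
open Summit.AtomisticToContinuum.Crystallization.Theorems.PalmUnimodularRigidity
open Literature.MathematicalPhysics.StatisticalMechanics Literature.Geometry.DiscreteGeometry
open Literature.Probability.Process

/-- **P5 `ChargeFromLaw` (stub `stub_chargeFromLaw` of line `palm-good-law`, crux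
stmt-AtomisticToContinuum-13603).** Under the crux's antecedent (defect fraction `→ 0` along every
ground-state sequence), the good limit law (P1), its root shells (P3a), the Barlow chart (9227) and hcp
selection (9226) charge one relaxed hcp periodic configuration with positive density at every scale,
frequently in `N`: `GroundStatesChargePeriodic`.  See the module docstring for the proof. -/
theorem stub_chargeFromLaw : ChargeFromLaw := by
  intro h1 h3 hChart hSelect hZ x hx
  obtain ⟨φ, δ, P, hφ, hδ, hP, hcore, hstat, hE, htr, hgood⟩ := h1 x hx (hZ x hx)
  -- Step 1: the good limit law is minimising
  have hLim : PalmUnimodularRigidity.CrysEnergyLimit := PalmUnimodularRigidity.CrysEnergyLimit_holds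
  have hlim' : Tendsto (fun j : ℕ => groundStateEnergy lennardJones 3 (φ j) / (φ j : ℝ)) atTop
      (𝓝 (⨅ Q : PeriodicConfiguration 3, Q.energyPerParticle lennardJones)) :=
    hLim.comp hφ.tendsto_atTop
  have hEq := tendsto_nhds_unique hE hlim'
  -- Step 2: good root shell a.s. (P3a)
  have hroot := h3 δ hδ P hP hcore hstat hEq.le hgood
  -- hard-core configurations are locally finite
  have hlf : ∀ᵐ μ ∂P, ∀ n : ℕ,
      μ ((fun z : EuclideanSpace ℝ (Fin 3) => ⌊‖z‖⌋₊) ⁻¹' {n}) < ∞ := by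
    filter_upwards [hcore] with μ hμ n
    obtain ⟨S, -, hsep, rfl⟩ := hμ
    exact count_restrict_floorNorm_preimage_lt_top hδ hsep n
  -- good shell at every point a.s., chart (9227), hcp selection (9226)
  have hall := ae_forall_map_sub_of_ae hstat hlf hroot
  have hae := hSelect δ hδ P hP hcore hstat hEq.le (by
    filter_upwards [hcore, hall] with μ hc ha
    obtain ⟨S, h0, -, rfl⟩ := hc
    refine ⟨S, rfl, ?good, hChart S ⟨0, h0⟩ ?good⟩
    intro y hy
    obtain ⟨a, ha1, ha2, T, hT, hsh⟩ := ha y ((count_restrict_singleton_ne_zero_iff S y).2 hy)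
    refine ⟨a, ha1, ha2, T, ?_, hsh⟩
    rw [hT, map_sub_count_restrict, shell_image_sub_eq])
  -- Step 3: support point + density transfer (verbatim the end of `palmToHinge_proof`)
  -- the parameter box and the parametrised event
  set K : Set (ℝ × ℝ) := Icc (1 / 2 : ℝ) 2 ×ˢ Icc (1 / 2 : ℝ) 2 with hKdef
  have hK : IsCompact K := isCompact_Icc.prod isCompact_Icc
  set p : Measure (EuclideanSpace ℝ (Fin 3)) → ℝ × ℝ → Prop := fun μ z =>
    (1 / 2 ≤ z.1 ∧ z.1 ≤ 2 ∧ 1 / 2 ≤ z.2 ∧ z.2 ≤ 2) ∧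
      ∃ A : EuclideanSpace ℝ (Fin 3) ≃ₗᵢ[ℝ] EuclideanSpace ℝ (Fin 3),
        μ = (Measure.count : Measure (EuclideanSpace ℝ (Fin 3))).restrict
          (A '' hcpStacking z.1 z.2)
    with hpdef
  have hae' : ∀ᵐ μ ∂P, ∃ z ∈ K, p μ z := by
    filter_upwards [hae] with μ hμ
    obtain ⟨a, h, _, _, h1, h2, h3, h4, A, -, hμ⟩ := hμ
    exact ⟨(a, h), ⟨⟨h1, h2⟩, ⟨h3, h4⟩⟩, ⟨h1, h2, h3, h4⟩, A, hμ⟩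
  haveI : NeZero P := ⟨IsProbabilityMeasure.ne_zero P⟩
  obtain ⟨⟨a₀, h₀⟩, hzK, hsupp⟩ := exists_mem_forall_nhds_measure_ne_zero P hK p hae'
  obtain ⟨⟨ha₀, ha₀'⟩, ⟨hh₀, hh₀'⟩⟩ := hzK
  have ha₀0 : a₀ ≠ 0 := by intro h0; rw [h0] at ha₀; norm_num at ha₀
  have hh₀0 : h₀ ≠ 0 := by intro h0; rw [h0] at hh₀; norm_num at hh₀
  refine ⟨hcpPeriodicConfiguration ha₀0 hh₀0, ?_⟩
  intro R ε hR hε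
  -- tolerances
  set η : ℝ := ε / (4 * (R + ε)) with hηdef
  have hRε : 0 < R + ε := by positivity
  have hηpos : 0 < η := by positivity
  have hηRε : 4 * η * (R + ε) ≤ ε := by
    rw [hηdef]; field_simp; exact le_rfl
  -- the charged set of nearby crystals
  set T : Set (Measure (EuclideanSpace ℝ (Fin 3))) :=
    {μ | ∃ z ∈ Metric.ball ((a₀, h₀) : ℝ × ℝ) η, p μ z} with hTdef
  have hT : P T ≠ 0 := hsupp _ (Metric.ball_mem_nhds _ hηpos)
  have hTreal : 0 < (P T).toReal := ENNReal.toReal_pos hT (measure_ne_top P T)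
  refine ⟨(P T).toReal / 2, half_pos hTreal, ?_⟩
  have hev := htr T (R + ε) (ε / 2) (half_pos hε) ((P T).toReal / 2) (half_lt_self hTreal)
  -- the property transferred to `N = φ j`
  set good : (N : ℕ) → Fin N → Prop := fun N i =>
    ∃ A : EuclideanSpace ℝ (Fin 3) →ₗᵢ[ℝ] EuclideanSpace ℝ (Fin 3),
      ∃ q ∈ (hcpPeriodicConfiguration ha₀0 hh₀0).points,
      (∀ s ∈ (hcpPeriodicConfiguration ha₀0 hh₀0).points, dist s q ≤ R →
        ∃ j : Fin N, dist (x N j) (x N i + A (s - q)) ≤ ε) ∧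
      (∀ j : Fin N, dist (x N j) (x N i) ≤ R →
        ∃ s ∈ (hcpPeriodicConfiguration ha₀0 hh₀0).points, dist (x N j) (x N i + A (s - q)) ≤ ε)
    with hgood_def
  have himp : ∀ (N : ℕ) (i : Fin N),
      (∃ ν ∈ T, ((∀ p : EuclideanSpace ℝ (Fin 3), ν {p} ≠ 0 → ‖p‖ ≤ R + ε →
          ∃ q ∈ (Set.range (fun k : Fin N => x N k - x N i)), dist q p ≤ ε / 2) ∧
        (∀ q ∈ (Set.range (fun k : Fin N => x N k - x N i)), ‖q‖ ≤ R + ε →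
          ∃ p : EuclideanSpace ℝ (Fin 3), ν {p} ≠ 0 ∧ dist q p ≤ ε / 2))) → good N i := by
    rintro N i ⟨ν, ⟨⟨a, h⟩, hz, ⟨ha, ha', hh, hh'⟩, A, rfl⟩, h1, h2⟩
    rw [Metric.mem_ball, Prod.dist_eq, max_lt_iff, Real.dist_eq, Real.dist_eq] at hz
    have h1' : ∀ p : EuclideanSpace ℝ (Fin 3), p ∈ A '' hcpStacking a h → ‖p‖ ≤ R + ε →
        ∃ q ∈ Set.range (fun k : Fin N => x N k - x N i), dist q p ≤ ε / 2 := fun p hp =>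
      h1 p ((count_restrict_singleton_ne_zero_iff _ p).2 hp)
    have h2' : ∀ q ∈ Set.range (fun k : Fin N => x N k - x N i), ‖q‖ ≤ R + ε →
        ∃ p : EuclideanSpace ℝ (Fin 3), p ∈ A '' hcpStacking a h ∧ dist q p ≤ ε / 2 :=
      fun q hq hqn => (h2 q hq hqn).imp fun p hp =>
        ⟨(count_restrict_singleton_ne_zero_iff _ p).1 hp.1, hp.2⟩
    obtain ⟨c1, c2⟩ := matched_hcp_of_matched_near ha₀ hh₀ ha hh hηpos.le hz.1.le hz.2.le hε.le
      hηRε A (x N) i h1' h2'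
    refine ⟨A.toLinearIsometry, 0, ?_, ?_, ?_⟩
    · rw [hcpPeriodicConfiguration_points]; exact zero_mem_hcpStacking a₀ h₀
    · rw [hcpPeriodicConfiguration_points]; exact c1
    · rw [hcpPeriodicConfiguration_points]; exact c2
  have hev' : ∀ᶠ j : ℕ in atTop,
      (P T).toReal / 2 * ((φ j : ℕ) : ℝ) ≤ (Nat.card {i : Fin (φ j) // good (φ j) i} : ℝ) := by
    filter_upwards [hev] with j hj
    refine hj.trans ?_
    exact_mod_cast Nat.card_le_card_of_injective _
      (Subtype.map_injective (fun i hi => himp (φ j) i hi) Function.injective_id)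
  exact hφ.tendsto_atTop.frequently
    (p := fun N : ℕ => (P T).toReal / 2 * (N : ℝ) ≤ (Nat.card {i : Fin N // good N i} : ℝ))
    hev'.frequently

end Summit.AtomisticToContinuum.Crystallization.Theorems.PalmGoodLaw

end
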